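import Mathlib
import Summits.Ventures.HodgeRepro2.PeterssonNorm

/-!
# `|det α| = 1` on `U(2,1)` and the invariant volume density of the ball

Kernel annex of the blind cell `pub-hodge-repro2` (seat p2), Tier-3 hypothesis shapes of
`Hypothesis.lean`.  The Petersson inner product of the brief's automorphic forms is taken
against the `U(2,1)`-invariant volume form `(1 − ‖z‖²)^{−3} dV` of the ball (the Bergman volume;
Sh79 §5).  This file records, in the coordinates of `Hypothesis.lean`:

* `IsInU21.norm_det_eq_one`: `|det α| = 1` for `α ∈ U(2,1)` (from `αᴴ J α = J`);
* `IsInU21.norm_det_jacobian`: `|det J_α(z)| = |j(α, z)|^{−3}` (with `det_jacobian_eq`);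
* **`volumeDensity_ballAction`**: the density `(1 − ‖z‖²)^{−3}` satisfies
  `|det J_α(z)|² · (1 − ‖αz‖²)^{−3} = (1 − ‖z‖²)^{−3}` — the change-of-variables identity that
  makes `(1 − ‖z‖²)^{−3} dV` invariant under the ball action (`|det J_α|²` is the real Jacobian
  of the holomorphic map `z ↦ αz`).
-/

namespace Summit.Ventures.HodgeRepro2.ShimuraData

/-- `|det α| = 1` for `α ∈ U(2,1)`: `det(αᴴ) det J det α = det J` with `det J = −1`. -/
theorem IsInU21.norm_det_eq_one {α : Matrix (Fin 3) (Fin 3) ℂ} (hα : IsInU21 α) :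
    ‖α.det‖ = 1 := by
  have h := congrArg Matrix.det hα
  rw [Matrix.det_mul, Matrix.det_mul, Matrix.det_conjTranspose, det_J21] at h
  -- `star (det α) * (−1) * det α = −1`
  have h2 : (starRingEnd ℂ) α.det * α.det = 1 := by
    have : star α.det * -1 * α.det = -1 := h
    linear_combination -this
  have h3 : Complex.normSq α.det = 1 := by
    have := Complex.mul_conj α.det
    rw [mul_comm, h2] at this
    exact_mod_cast this.symm
  rw [Complex.normSq_eq_norm_sq] at h3
  nlinarith [norm_nonneg α.det, sq_nonneg (‖α.det‖ - 1), sq_nonneg (‖α.det‖ + 1)]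

/-- `|det J_α(z)| = |j(α, z)|^{−3}` for `α ∈ U(2,1)` and `z` in the ball. -/
theorem IsInU21.norm_det_jacobian {α : Matrix (Fin 3) (Fin 3) ℂ} (hα : IsInU21 α)
    {z : Fin 2 → ℂ} (hz : z ∈ ball₂) :
    ‖(jacobian α z).det‖ = (‖autFactor α z‖ ^ 3)⁻¹ := by
  rw [det_jacobian_eq hα hz, norm_div, hα.norm_det_eq_one, norm_pow, one_div]

/-- The invariant volume density of the ball, `(1 − ‖z‖²)^{−3}`. -/
noncomputable def volumeDensity (z : Fin 2 → ℂ) : ℝ := ((1 - normSq₂ z) ^ 3)⁻¹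

/-- **Invariance of the Bergman volume density**: for `α ∈ U(2,1)` and `z` in the ball,
`|det J_α(z)|² · (1 − ‖αz‖²)^{−3} = (1 − ‖z‖²)^{−3}`. -/
theorem volumeDensity_ballAction {α : Matrix (Fin 3) (Fin 3) ℂ} (hα : IsInU21 α)
    {z : Fin 2 → ℂ} (hz : z ∈ ball₂) :
    ‖(jacobian α z).det‖ ^ 2 * volumeDensity (ballAction α z) = volumeDensity z := by
  have hD : ‖autFactor α z‖ ≠ 0 := norm_ne_zero_iff.2 (hα.autFactor_ne_zero hz)
  have h1 : (1 - normSq₂ z) ≠ 0 := (sub_pos.2 (normSq₂_lt_one hz)).ne'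
  rw [volumeDensity, volumeDensity, hα.norm_det_jacobian hz, one_sub_normSq₂_ballAction hα hz]
  field_simp

end Summit.Ventures.HodgeRepro2.ShimuraData
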